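import Summits.AnomalousDissipation.AnomalousDissipation.Theorems.BaireTransferRobustLoudUpgradeLine
import Literature.Analysis.FluidPDE.SteadyNSLatticePersistence

/-!
# Stub `stub_steadyPersist` of the line `malkin-cone-group-orbits` (crux `BaireTransfer.RobustLoudUpgrade`)

`nondegSteady S a E ε ⊆ persistSteady S a E ε`: a mean-zero classical steady state `u₀` of
`NS_ν(f_c)` (`ν > 0`) whose linearisation has no classical kernel in the mean-zero class
(`¬ Torus.IsLinNSEigenvalue ν u₀ 0`) persists `H¹`-continuously under small changes of the
coefficient vector `c` at the same viscosity (`SteadyPersistsAt`) — the steady implicit-function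
theorem at fixed viscosity (Temam 1979, Ch. II §1; Foias–Temam 1977; Saut–Temam 1980, §2).

The lattice machinery (state space `W ⊂ ℓ²(ℤ³; ℂ³)`, bounded bilinear map, compactness of the
linearised convective operator, Fredholm alternative, inverse function theorem, lattice elliptic
regularity, and the dictionary with classical steady states / eigenvectors) is the Literature file
`Literature/Analysis/FluidPDE/SteadyNSLatticePersistence.lean` (`SteadyLattice.*`). Here:
§J the force map `c ↦ f_c` (linear, smooth, divergence free, mean zero; its Fourier coefficients
as an `ℝ`-linear map into `W`), §L the assembly `steadyPersistsAt_of_nondeg` (base point from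
`fourier_eq_of_isSteadyNSState`, injectivity of the linearisation from lattice regularity and the
spectral hypothesis via `isLinNSEigenvalue_of_fourier`, local inversion, the perturbed classical
state via `steadyState_of_fourier`, and the Parseval `H¹` estimate `h1_le_of_coeff`), and the
registered stub. Pure proof file (no definitions).
-/

-- `Summit.<Summit>.<Problem>` is the tree's mandated summit-side namespace (CONVENTIONS §2); for this
-- single-conjunct summit the two coincide, so the duplicate is deliberate.
set_option linter.dupNamespace false

noncomputable section

open scoped BigOperators Topology ENNReal NNReal InnerProductSpace ComplexConjugate
open Filter Set Function TopologicalSpace MeasureTheory UnitAddTorus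

namespace Summit.AnomalousDissipation.AnomalousDissipation.Theorems.RobustLoudUpgrade.SteadyPersist

open Literature.Analysis.FunctionSpaces Literature.Analysis.FunctionSpaces.Torus
open Literature.Analysis.FunctionSpaces.EuclideanSpace
open Literature.Analysis.FluidPDE
open Literature.Analysis.FluidPDE.ScalarFourier
open Literature.Analysis.FluidPDE.SteadyLattice
open Summit.AnomalousDissipation.AnomalousDissipation.Theses.BaireTransfer

/-! ## §J The force map `c ↦ f_c` (wrappers over `SteadyLattice.*` for the route's `force`) -/

section Force

variable {S : Finset (Fin 3 → ℤ)}

/-- `f_c` is smooth. [folklore] -/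
theorem isSmooth_force' (c : Coeff S) : IsSmooth (force S c) := isSmooth_projForce c

/-- `f_c` is divergence free. [folklore] -/
theorem isDivFree_force' (c : Coeff S) : IsDivFree (force S c) := isDivFree_projForce c

/-- `f_c` has zero mean. [folklore] -/
theorem hasZeroMean_force' (c : Coeff S) : HasZeroMean (force S c) := hasZeroMean_projForce c

/-- The Fourier coefficients of `f_c` decay rapidly. [folklore] -/
theorem rapidDecay_forceCoeff (c : Coeff S) : RapidDecay (mFourierCoeff (complexify ∘ force S c)) :=
  rapidDecay_projForceCoeff c

/-- The Leray multiplier fixes the coefficients of `f_c`. [folklore] -/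
theorem lerayCoeff_forceCoeff (c : Coeff S) (k : (Fin 3 → ℤ)) :
    Torus.lerayCoeff k (mFourierCoeff (complexify ∘ force S c) k) = mFourierCoeff (complexify ∘ force S c) k :=
  lerayCoeff_projForceCoeff c k

variable {W : Submodule ℝ (lp (fun _ : Fin 3 → ℤ => EuclideanSpace ℂ (Fin 3)) 2)} (hW : ∀ x : (lp (fun _ : Fin 3 →
    ℤ => EuclideanSpace ℂ (Fin 3)) 2), x ∈ W ↔ (((x : (Fin 3 → ℤ) → (EuclideanSpace ℂ (Fin 3))) : (Fin 3 → ℤ) →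
    EuclideanSpace ℂ (Fin 3)) 0 = 0 ∧ (∀ kk : Fin 3 → ℤ, (∑ jj : Fin 3, ((kk jj : ℤ) : ℂ) * (((x : (Fin 3 → ℤ) →
    (EuclideanSpace ℂ (Fin 3))) : (Fin 3 → ℤ) → EuclideanSpace ℂ (Fin 3)) kk) jj) = 0) ∧ IsConjSymm ((x : (Fin 3 → ℤ)
    → (EuclideanSpace ℂ (Fin 3))) : (Fin 3 → ℤ) → EuclideanSpace ℂ (Fin 3))))
include hW

/-- The Fourier coefficients of `f_{c'}` as an `ℝ`-linear map `Coeff S →ₗ W`. [folklore] -/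
theorem exists_forceMap : ∃ Fm : Coeff S →ₗ[ℝ] W,
    ∀ c' : Coeff S, (((Fm c' : W) : (lp (fun _ : Fin 3 → ℤ => EuclideanSpace ℂ (Fin 3)) 2)) : (Fin 3 → ℤ) →
        (EuclideanSpace ℂ (Fin 3))) = mFourierCoeff (complexify ∘ force S c') :=
  exists_projForceMap hW

end Force

/-! ## §L Assembly: the steady implicit-function theorem at fixed viscosity -/

section Assembly

variable {S : Finset (Fin 3 → ℤ)}

set_option maxHeartbeats 1600000 in
/-- **Steady implicit-function theorem at fixed viscosity** (Temam 1979 Ch. II §1; Foias–Temam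
1977; Saut–Temam 1980 §2), in the classical formulation of the line: a mean-zero classical
steady state `u₀` of `NS_ν(f_c)`, `ν > 0`, whose linearisation has no classical kernel in the
mean-zero class persists `H¹`-continuously under small changes of `c`. [folklore] -/
theorem steadyPersistsAt_of_nondeg {c : Coeff S} {ν : ℝ} (hν : 0 < ν) {u₀ : (UnitAddTorus (Fin 3)) → (EuclideanSpace ℝ
    (Fin 3))} {p₀ : (UnitAddTorus (Fin 3)) → ℝ}
    (hst : Torus.IsSteadyNSState ν (force S c) u₀ p₀) (h0 : HasZeroMean u₀)
    (hnd : ¬ Torus.IsLinNSEigenvalue ν u₀ 0) : SteadyPersistsAt S c ν u₀ := by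
  intro δ hδ
  -- §1 the unperturbed state on the Fourier side
  have hu₀ : IsSmooth u₀ := hst.smooth_velocity.isSmooth_slice (Set.mem_univ 0)
  have hdiv₀ : IsDivFree u₀ := hst.divFree 0 (Set.mem_univ 0)
  set a : (Fin 3 → ℤ) → (EuclideanSpace ℂ (Fin 3)) := mFourierCoeff (complexify ∘ u₀) with ha
  have har : RapidDecay a := hu₀.complexify_comp.rapidDecay_mFourierCoeff
  have hat : ∀ m : (Fin 3 → ℤ), (∑ jj : Fin 3, ((m jj : ℤ) : ℂ) * (a m) jj) = 0 :=
      fun m => hdiv₀.sum_mul_mFourierCoeff_eq_zero hu₀ m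
  have ha0 : a 0 = 0 := mFourierCoeff_complexify_zero_of_hasZeroMean hu₀ h0
  have hacs : IsConjSymm a := isConjSymm_mFourierCoeff hu₀.integrable
  have heq₀ : ∀ k : (Fin 3 → ℤ), (((ν * (4 * Real.pi ^ 2 * freqNormSq k)) : ℝ) : ℂ) • a k + Torus.lerayCoeff k
      ((WithLp.toLp 2 (fun pp : Fin 3 => transportSym (fun jj mm => a mm jj) (fun mm => a mm pp) k) : EuclideanSpace ℂ
      (Fin 3))) =
      mFourierCoeff (complexify ∘ force S c) k := fun k => by
    rw [ha, fourier_eq_of_isSteadyNSState hst (isSmooth_force' c) h0 k, lerayCoeff_forceCoeff]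
  -- §2 the state space, the bilinear map, the force map
  obtain ⟨W, hW, hWc⟩ := exists_space
  haveI : CompleteSpace W := completeSpace_W hWc
  obtain ⟨B, hB, hBb⟩ := exists_bilinear hW
  obtain ⟨Fm, hFm⟩ := exists_forceMap (S := S) hW
  -- §3 the base point `x₀`
  set X₀ : (Fin 3 → ℤ) → (EuclideanSpace ℂ (Fin 3)) := fun k => ((freqNormSq k : ℝ) : ℂ) • a k with hX₀
  have hX₀r : RapidDecay X₀ := by
    refine har.of_norm_le_mul_pow (C := 1) (s := 1) fun k => ?_
    rw [hX₀]
    dsimp only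
    rw [norm_smul, Complex.norm_real, Real.norm_of_nonneg (freqNormSq_nonneg k), one_mul, pow_one]
    exact mul_le_mul_of_nonneg_right (by linarith [freqNormSq_nonneg k]) (norm_nonneg _)
  have hX₀V : ((X₀ : (Fin 3 → ℤ) → EuclideanSpace ℂ (Fin 3)) 0 = 0 ∧ (∀ kk : Fin 3 → ℤ, (∑ jj : Fin 3, ((kk jj : ℤ) :
      ℂ) * ((X₀ : (Fin 3 → ℤ) → EuclideanSpace ℂ (Fin 3)) kk) jj) = 0) ∧ IsConjSymm (X₀ : (Fin 3 → ℤ) → EuclideanSpace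
      ℂ (Fin 3))) := by
    refine ⟨by simp [hX₀, freqNormSq_zero], fun k => by rw [hX₀]; dsimp only; rw [kdot_smul, hat k, mul_zero],
      fun k => ?_⟩
    rw [hX₀]
    dsimp only
    rw [freqNormSq_neg, hacs k, conjVec_smul, Complex.conj_ofReal]
  set x₀ : W := ⟨⟨X₀, memℓp_two_of_rapidDecay hX₀r⟩, (hW _).2 hX₀V⟩ with hx₀def
  have hx₀ : ((x₀ : (lp (fun _ : Fin 3 → ℤ => EuclideanSpace ℂ (Fin 3)) 2)) : (Fin 3 → ℤ) → (EuclideanSpace ℂ (Fin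
      3))) = X₀ := rfl
  have hcf : ((fun mm : Fin 3 → ℤ => (((freqNormSq mm)⁻¹ : ℝ) : ℂ)) • (((x₀ : (lp (fun _ : Fin 3 → ℤ => EuclideanSpace
      ℂ (Fin 3)) 2)) : (Fin 3 → ℤ) → (EuclideanSpace ℂ (Fin 3))) : (Fin 3 → ℤ) → EuclideanSpace ℂ (Fin 3))) =
      a := by rw [hx₀, hX₀]; exact cf_weight_smul ha0
  -- §4 the steady map and its derivative
  set cν : ℝ := 4 * Real.pi ^ 2 * ν with hcν
  have hcν0 : cν ≠ 0 := by positivity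
  set G : W → W := fun x => cν • x + B x x with hG
  set K : W →L[ℝ] W := (hBb.deriv (x₀, x₀)).comp ((ContinuousLinearMap.id ℝ W).prod (ContinuousLinearMap.id ℝ W))
    with hK
  have hKw : ∀ w, K w = B x₀ w + B w x₀ := fun w => by simp [hK, IsBoundedBilinearMap.deriv_apply]
  have hGd : HasStrictFDerivAt G (cν • ContinuousLinearMap.id ℝ W + K) x₀ := hasStrictFDerivAt_steadyMap hBb cν x₀
  have hKc : IsCompactOperator K := isCompactOperator_linearised hWc hB x₀ (by rw [hcf]; exact har) K hKw
  -- coordinates of `G`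
  have hGcoe : ∀ x : W, (((G x : W) : (lp (fun _ : Fin 3 → ℤ => EuclideanSpace ℂ (Fin 3)) 2)) : (Fin 3 → ℤ) →
      (EuclideanSpace ℂ (Fin 3))) = fun k => ((cν : ℝ) : ℂ) • ((x : (lp (fun _ : Fin 3 → ℤ => EuclideanSpace ℂ (Fin
      3)) 2)) : (Fin 3 → ℤ) → (EuclideanSpace ℂ (Fin 3))) k +
      Torus.lerayCoeff k ((WithLp.toLp 2 (fun pp : Fin 3 => transportSym (fun jj mm => (((fun mm : Fin 3 →
          ℤ => (((freqNormSq mm)⁻¹ : ℝ) : ℂ)) • (((x : (lp (fun _ : Fin 3 → ℤ => EuclideanSpace ℂ (Fin 3)) 2)) : (Fin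
          3 → ℤ) → (EuclideanSpace ℂ (Fin 3))) : (Fin 3 → ℤ) → EuclideanSpace ℂ (Fin 3)))) mm jj) (fun mm => (((fun
          mm : Fin 3 → ℤ => (((freqNormSq mm)⁻¹ : ℝ) : ℂ)) • (((x : (lp (fun _ : Fin 3 → ℤ => EuclideanSpace ℂ (Fin
          3)) 2)) : (Fin 3 → ℤ) → (EuclideanSpace ℂ (Fin 3))) : (Fin 3 → ℤ) → EuclideanSpace ℂ (Fin 3)))) mm pp) k) :
          EuclideanSpace ℂ (Fin 3))) := by
    intro x
    rw [hG]
    dsimp only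
    rw [coeW_add, coeW_smul, hB]
    funext k
    simp only [Pi.add_apply, Pi.smul_apply, Complex.coe_smul]
  -- §5 injectivity of the linearisation (regularity + the spectral hypothesis)
  have hinj : ∀ w : W, cν • w + K w = 0 → w = 0 := by
    intro w hw0
    have hco : ∀ k : (Fin 3 → ℤ), (((4 * Real.pi ^ 2 * ν : ℝ)) : ℂ) • ((w : (lp (fun _ : Fin 3 → ℤ => EuclideanSpace ℂ
        (Fin 3)) 2)) : (Fin 3 → ℤ) → (EuclideanSpace ℂ (Fin 3))) k +
        Torus.lerayCoeff k ((WithLp.toLp 2 (fun pp : Fin 3 => transportSym (fun jj mm => a mm jj) (fun mm => (((fun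
            mm : Fin 3 → ℤ => (((freqNormSq mm)⁻¹ : ℝ) : ℂ)) • (((w : (lp (fun _ : Fin 3 → ℤ => EuclideanSpace ℂ (Fin
            3)) 2)) : (Fin 3 → ℤ) → (EuclideanSpace ℂ (Fin 3))) : (Fin 3 → ℤ) → EuclideanSpace ℂ (Fin 3)))) mm pp)
            k) : EuclideanSpace ℂ (Fin 3)) + (WithLp.toLp 2 (fun pp : Fin 3 => transportSym (fun jj mm => (((fun mm :
            Fin 3 → ℤ => (((freqNormSq mm)⁻¹ : ℝ) : ℂ)) • (((w : (lp (fun _ : Fin 3 → ℤ => EuclideanSpace ℂ (Fin 3))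
            2)) : (Fin 3 → ℤ) → (EuclideanSpace ℂ (Fin 3))) : (Fin 3 → ℤ) → EuclideanSpace ℂ (Fin 3)))) mm jj) (fun
            mm => a mm pp) k) : EuclideanSpace ℂ (Fin 3))) = 0 := by
      intro k
      have h := congrArg (fun z : W => (((z : W) : (lp (fun _ : Fin 3 → ℤ => EuclideanSpace ℂ (Fin 3)) 2)) : (Fin 3 →
          ℤ) → (EuclideanSpace ℂ (Fin 3))) k) hw0
      dsimp only at h
      rw [coeW_add, hKw, coeW_add, coeW_smul, hB, hB, hcf] at h
      simp only [Pi.add_apply, Pi.smul_apply] at h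
      rw [← lerayCoeff_add', ← Complex.coe_smul, Submodule.coe_zero] at h
      rw [← hcν]
      exact h
    have hwr : RapidDecay (((fun mm : Fin 3 → ℤ => (((freqNormSq mm)⁻¹ : ℝ) : ℂ)) • (((w : (lp (fun _ : Fin 3 →
        ℤ => EuclideanSpace ℂ (Fin 3)) 2)) : (Fin 3 → ℤ) → (EuclideanSpace ℂ (Fin 3))) : (Fin 3 → ℤ) → EuclideanSpace
        ℂ (Fin 3)))) :=
      rapidDecay_of_linearised_eq hν har hat (w : (lp (fun _ : Fin 3 → ℤ => EuclideanSpace ℂ (Fin 3)) 2)) (W_trans hW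
          w) hco
    by_contra hwne
    have hcfne : ((fun mm : Fin 3 → ℤ => (((freqNormSq mm)⁻¹ : ℝ) : ℂ)) • (((w : (lp (fun _ : Fin 3 →
        ℤ => EuclideanSpace ℂ (Fin 3)) 2)) : (Fin 3 → ℤ) → (EuclideanSpace ℂ (Fin 3))) : (Fin 3 → ℤ) → EuclideanSpace
        ℂ (Fin 3))) ≠ 0 := by
      intro hz
      apply hwne
      refine Subtype.ext (lp.ext (funext fun k => ?_))
      rw [Submodule.coe_zero]
      change ((w : (lp (fun _ : Fin 3 → ℤ => EuclideanSpace ℂ (Fin 3)) 2)) : (Fin 3 → ℤ) → (EuclideanSpace ℂ (Fin 3)))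
          k = 0
      by_cases hk : k = 0
      · subst hk; exact W_zero hW w
      · have h := congrFun hz k
        rw [cf_apply, Pi.zero_apply, smul_eq_zero] at h
        rcases h with h | h
        · exfalso
          have hf : freqNormSq k ≠ 0 := ne_of_gt (lt_of_lt_of_le one_pos (one_le_freqNormSq' hk))
          exact hf (inv_eq_zero.1 (by exact_mod_cast h))
        · exact h
    have heqc : ∀ k : (Fin 3 → ℤ), (((ν * (4 * Real.pi ^ 2 * freqNormSq k)) : ℝ) : ℂ) • (((fun mm : Fin 3 →
        ℤ => (((freqNormSq mm)⁻¹ : ℝ) : ℂ)) • (((w : (lp (fun _ : Fin 3 → ℤ => EuclideanSpace ℂ (Fin 3)) 2)) : (Fin 3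
        → ℤ) → (EuclideanSpace ℂ (Fin 3))) : (Fin 3 → ℤ) → EuclideanSpace ℂ (Fin 3)))) k +
        Torus.lerayCoeff k ((WithLp.toLp 2 (fun pp : Fin 3 => transportSym (fun jj mm => a mm jj) (fun mm => (((fun
            mm : Fin 3 → ℤ => (((freqNormSq mm)⁻¹ : ℝ) : ℂ)) • (((w : (lp (fun _ : Fin 3 → ℤ => EuclideanSpace ℂ (Fin
            3)) 2)) : (Fin 3 → ℤ) → (EuclideanSpace ℂ (Fin 3))) : (Fin 3 → ℤ) → EuclideanSpace ℂ (Fin 3)))) mm pp)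
            k) : EuclideanSpace ℂ (Fin 3)) + (WithLp.toLp 2 (fun pp : Fin 3 => transportSym (fun jj mm => (((fun mm :
            Fin 3 → ℤ => (((freqNormSq mm)⁻¹ : ℝ) : ℂ)) • (((w : (lp (fun _ : Fin 3 → ℤ => EuclideanSpace ℂ (Fin 3))
            2)) : (Fin 3 → ℤ) → (EuclideanSpace ℂ (Fin 3))) : (Fin 3 → ℤ) → EuclideanSpace ℂ (Fin 3)))) mm jj) (fun
            mm => a mm pp) k) : EuclideanSpace ℂ (Fin 3))) = 0 := fun k => by
      rw [← smul_eq_weight_smul_cf (W_zero hW w) k]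
      exact hco k
    exact hnd (isLinNSEigenvalue_of_fourier hu₀ hdiv₀ hwr (cf_transversal (W_trans hW w)) (cf_zero _) hcfne heqc)
  -- §6 the derivative is an isomorphism; local inversion
  obtain ⟨L, hL⟩ := exists_equiv_of_injective hKc hcν0 hinj
  have hLeq : (L : W →L[ℝ] W) = cν • ContinuousLinearMap.id ℝ W + K := by
    ext w
    simp [hL w]
  have hGd' : HasStrictFDerivAt G (L : W →L[ℝ] W) x₀ := by rw [hLeq]; exact hGd
  have hGx₀ : G x₀ = Fm c := by
    refine Subtype.ext (lp.ext (funext fun k => ?_))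
    rw [hGcoe, hFm, hcf]
    dsimp only
    rw [hx₀, ← heq₀ k, smul_eq_weight_smul_cf (by simp [hX₀, freqNormSq_zero]) k, hX₀]
    dsimp only
    rw [show ((fun mm : Fin 3 → ℤ => (((freqNormSq mm)⁻¹ : ℝ) : ℂ)) • ((fun k : (Fin 3 → ℤ) => ((freqNormSq k : ℝ) :
        ℂ) • a k) : (Fin 3 → ℤ) → EuclideanSpace ℂ (Fin 3))) = a from cf_weight_smul ha0]
  -- radii
  set δ' : ℝ := min 1 (δ / (2 * (1 + 4 * Real.pi ^ 2))) with hδ'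
  have hδ'0 : 0 < δ' := lt_min one_pos (by positivity)
  have hδ'1 : δ' ≤ 1 := min_le_left _ _
  have hδ'2 : δ' ≤ δ / (2 * (1 + 4 * Real.pi ^ 2)) := min_le_right _ _
  obtain ⟨r, hr, hsolve⟩ := local_solve hGd' hδ'0
  have hFc : Continuous Fm := LinearMap.continuous_of_finiteDimensional Fm
  obtain ⟨r', hr', hball⟩ := Metric.continuous_iff.1 hFc c r hr
  refine ⟨r', hr', fun c' hc' => ?_⟩
  obtain ⟨x, hGx, hdist⟩ := hsolve (Fm c') (by rw [hGx₀]; exact hball c' hc')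
  -- §7 the perturbed solution is a classical steady state
  have hxeq : ∀ k : (Fin 3 → ℤ), (((4 * Real.pi ^ 2 * ν : ℝ)) : ℂ) • ((x : (lp (fun _ : Fin 3 → ℤ => EuclideanSpace ℂ
      (Fin 3)) 2)) : (Fin 3 → ℤ) → (EuclideanSpace ℂ (Fin 3))) k +
      Torus.lerayCoeff k ((WithLp.toLp 2 (fun pp : Fin 3 => transportSym (fun jj mm => (((fun mm : Fin 3 →
          ℤ => (((freqNormSq mm)⁻¹ : ℝ) : ℂ)) • (((x : (lp (fun _ : Fin 3 → ℤ => EuclideanSpace ℂ (Fin 3)) 2)) : (Fin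
          3 → ℤ) → (EuclideanSpace ℂ (Fin 3))) : (Fin 3 → ℤ) → EuclideanSpace ℂ (Fin 3)))) mm jj) (fun mm => (((fun
          mm : Fin 3 → ℤ => (((freqNormSq mm)⁻¹ : ℝ) : ℂ)) • (((x : (lp (fun _ : Fin 3 → ℤ => EuclideanSpace ℂ (Fin
          3)) 2)) : (Fin 3 → ℤ) → (EuclideanSpace ℂ (Fin 3))) : (Fin 3 → ℤ) → EuclideanSpace ℂ (Fin 3)))) mm pp) k) :
          EuclideanSpace ℂ (Fin 3))) =
      mFourierCoeff (complexify ∘ force S c') k := by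
    intro k
    have h := congrArg (fun z : W => (((z : W) : (lp (fun _ : Fin 3 → ℤ => EuclideanSpace ℂ (Fin 3)) 2)) : (Fin 3 → ℤ)
        → (EuclideanSpace ℂ (Fin 3))) k) hGx
    dsimp only at h
    rw [hGcoe, hFm] at h
    rw [← hcν]
    exact h
  have hxr : RapidDecay (((fun mm : Fin 3 → ℤ => (((freqNormSq mm)⁻¹ : ℝ) : ℂ)) • (((x : (lp (fun _ : Fin 3 →
      ℤ => EuclideanSpace ℂ (Fin 3)) 2)) : (Fin 3 → ℤ) → (EuclideanSpace ℂ (Fin 3))) : (Fin 3 → ℤ) → EuclideanSpace ℂ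
      (Fin 3)))) :=
    rapidDecay_of_steady_eq hν (x : (lp (fun _ : Fin 3 → ℤ => EuclideanSpace ℂ (Fin 3)) 2)) (W_trans hW x)
      (tsum_weight_mul_enorm_ne_top_of_rapidDecay (rapidDecay_forceCoeff c')) hxeq
  have hxeq' : ∀ k : (Fin 3 → ℤ), (((ν * (4 * Real.pi ^ 2 * freqNormSq k)) : ℝ) : ℂ) • (((fun mm : Fin 3 →
      ℤ => (((freqNormSq mm)⁻¹ : ℝ) : ℂ)) • (((x : (lp (fun _ : Fin 3 → ℤ => EuclideanSpace ℂ (Fin 3)) 2)) : (Fin 3 →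
      ℤ) → (EuclideanSpace ℂ (Fin 3))) : (Fin 3 → ℤ) → EuclideanSpace ℂ (Fin 3)))) k +
      Torus.lerayCoeff k ((WithLp.toLp 2 (fun pp : Fin 3 => transportSym (fun jj mm => (((fun mm : Fin 3 →
          ℤ => (((freqNormSq mm)⁻¹ : ℝ) : ℂ)) • (((x : (lp (fun _ : Fin 3 → ℤ => EuclideanSpace ℂ (Fin 3)) 2)) : (Fin
          3 → ℤ) → (EuclideanSpace ℂ (Fin 3))) : (Fin 3 → ℤ) → EuclideanSpace ℂ (Fin 3)))) mm jj) (fun mm => (((fun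
          mm : Fin 3 → ℤ => (((freqNormSq mm)⁻¹ : ℝ) : ℂ)) • (((x : (lp (fun _ : Fin 3 → ℤ => EuclideanSpace ℂ (Fin
          3)) 2)) : (Fin 3 → ℤ) → (EuclideanSpace ℂ (Fin 3))) : (Fin 3 → ℤ) → EuclideanSpace ℂ (Fin 3)))) mm pp) k) :
          EuclideanSpace ℂ (Fin 3))) =
      mFourierCoeff (complexify ∘ force S c') k := fun k => by
    rw [← smul_eq_weight_smul_cf (W_zero hW x) k]
    exact hxeq k
  obtain ⟨u', p', hst', hmean', hu', hû'⟩ := steadyState_of_fourier (isSmooth_force' c') (isDivFree_force' c')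
    (hasZeroMean_force' c') hxr (isConjSymm_cf (W_conj hW x)) (cf_transversal (W_trans hW x)) (cf_zero _) hxeq'
  refine ⟨u', p', hst', hmean', ?_⟩
  -- §8 the `H¹` estimate
  set z : W := x - x₀ with hz
  have hzn : ‖z‖ < δ' := by rwa [hz, ← dist_eq_norm]
  have hv : IsSmooth (fun y => u' y - u₀ y) := hu'.sub hu₀
  have hcoefv : mFourierCoeff (complexify ∘ fun y => u' y - u₀ y) = ((fun mm : Fin 3 → ℤ => (((freqNormSq mm)⁻¹ : ℝ) :
      ℂ)) • ((((z : W) : (lp (fun _ : Fin 3 → ℤ => EuclideanSpace ℂ (Fin 3)) 2)) : (Fin 3 → ℤ) → (EuclideanSpace ℂ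
      (Fin 3))) : (Fin 3 → ℤ) → EuclideanSpace ℂ (Fin 3))) := by
    have e : (complexify ∘ fun y => u' y - u₀ y : (UnitAddTorus (Fin 3)) → (EuclideanSpace ℂ (Fin 3))) = (complexify
        ∘ u') - (complexify ∘ u₀) := by
      funext y; simp
    rw [e, hz, coeW_sub]
    funext k
    rw [mFourierCoeff_sub hu'.complexify_comp.integrable hu₀.complexify_comp.integrable, hû', ← ha, ← hcf]
    simp only [Pi.smul_apply', Pi.sub_apply, smul_sub]
  have hH := h1_le_of_coeff hv (z : (lp (fun _ : Fin 3 → ℤ => EuclideanSpace ℂ (Fin 3)) 2)) hcoefv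
  rw [norm_coeW] at hH
  change (∫ y, ‖u' y - u₀ y‖ ^ 2) + gradNormSq (fun y => u' y - u₀ y) < δ
  have hpi : (0 : ℝ) < 1 + 4 * Real.pi ^ 2 := by positivity
  have hz2 : ‖z‖ ^ 2 ≤ δ' * δ' := by
    have := norm_nonneg z
    nlinarith
  have hd : δ' * δ' ≤ δ' := by nlinarith
  calc (∫ y, ‖u' y - u₀ y‖ ^ 2) + gradNormSq (fun y => u' y - u₀ y) ≤ (1 + 4 * Real.pi ^ 2) * ‖z‖ ^ 2 := hH
    _ ≤ (1 + 4 * Real.pi ^ 2) * δ' := by nlinarith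
    _ ≤ (1 + 4 * Real.pi ^ 2) * (δ / (2 * (1 + 4 * Real.pi ^ 2))) := mul_le_mul_of_nonneg_left hδ'2 hpi.le
    _ = δ / 2 := by field_simp
    _ < δ := by linarith

end Assembly

/-! ## The registered stub -/

/-- **Stub `stub_steadyPersist` of the line `malkin-cone-group-orbits`**: nondegenerate mean-zero
loud steady witnesses persist (`nondegSteady ⊆ persistSteady`), by the steady implicit-function
theorem at fixed viscosity `steadyPersistsAt_of_nondeg`. [folklore] -/
theorem stub_steadyPersist : ∀ (S : Finset (Fin 3 → ℤ)) (a E ε : ℝ), nondegSteady S a E ε ⊆ persistSteady S a E ε := by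
  intro S a E ε c hc
  obtain ⟨ν, hν, hνa, u₀, p₀, hst, h0, hE, hε, hnd⟩ := hc
  exact ⟨ν, hν, hνa, u₀, p₀, hst, h0, hE, hε, steadyPersistsAt_of_nondeg hν hst h0 hnd⟩

end Summit.AnomalousDissipation.AnomalousDissipation.Theorems.RobustLoudUpgrade.SteadyPersist

end
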